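import Summits.ResolutionOfSingularities.ResolutionOfSingularities.Theorems.FrobeniusClosingPatchingRelPerfectCuspLineStepGlue
import Summits.ResolutionOfSingularities.ResolutionOfSingularities.Theorems.FrobeniusClosingPatchingRelPerfectPointBlowupChartIterate
import Summits.ResolutionOfSingularities.ResolutionOfSingularities.Theorems.FrobeniusClosingPatchingRelPerfectTangentEuclidCharts
import HarnessLib

/-!
# Crux `PatchingRelPerfect` (stmt-ResolutionOfSingularities-16161), chain w52 — kernel certificate of
# the NON-GRADED DEPTH-FOUR member `(x₃² + x₀³) + 𝔪⁶`, part 1a: chart algebra of the line step and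
# the surface step on the `t`-chart (ring level)

[OURS · L1 W5.2 · kernel (iii) beyond F6, CHAIN v2.0 §1 (C)] On a `y`-chart of `Bl_𝔪 Spec S` the
member `I = (z² + w³) + 𝔪⁶` reads `u² · ((c² + u a³) + (u⁴))` (`u = y`, `c = z/y`, `a = w/y`):
exceptional depth FOUR, non-graded.  This seat's note `NONGRADED-DEPTH4-MEMBER.md` (evidence #59;
chart table kit j276688, evidence #60) finds it by 11 regular centres — `𝔪`; the line
`L₁ = V(u, a, c)`; the SURFACE `Π₂ = E₂ ∩ D̃_z`; then tangent Euclid `(2, 4)`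
(`CoreRungTower.tangent_euclid_two 3`, p527008) — with explicit `S`-avatars whose `y`-chart images
are `P = (a², c, u²)` (avatar of `Π₂`), `Σ = (c, u a, u²)` (avatar of `Σ̃`),
`K = (c² + u a³) + (u⁴)` (the member) and `B_m = (a^{2m-4}(c² + u a³)) + (c^m) + (u^{2m})`,
`m = 2, …, 7` (tangent-Euclid avatars).  This file: the pure ideal algebra of the three charts of
`Bl_{(t, a, c)}` for these factors (`aChart_*`, `tChart_*`, `cChart_*`, twist collection), and the
SURFACE STEP on the `t`-chart — `isRegular_of_isBlowup_Jt`: for `(T, C)` quasi-regular with regular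
quotient in a regular ring, every blowing up along `Jt · (T, C)`,
`Jt = (C, T) · (C², T²) · ∏_{k<6} ((T^k A^{2k}(C² + T² A³)) + (C^{k+2}) + (T^{k+2}))`, is regular (both
charts Cartier).  Part 1b (`…CuspDepthFourLineStep.lean`) assembles the line step.  FORMAT evidence
for the core on the `𝔪`-primary stratum; nothing here is a statement of the manuscript under review.

## References

* The Stacks Project, Tags 0804, 080A, 080B, 0BIQ. [StacksProject]
* Q. Liu, *Algebraic Geometry and Arithmetic Curves*, OUP 2002, Thm. 8.1.19 (a). [Liu2002]
-/

-- `Summit.<Summit>.<Sub>.Theorems` with `Sub = Summit` (single-conjunct summit, D-0017)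
set_option linter.dupNamespace false

noncomputable section

open CategoryTheory CategoryTheory.Limits AlgebraicGeometry Literature.AlgebraicGeometry.Resolution
open scoped Pointwise nonZeroDivisors

namespace Summit.ResolutionOfSingularities.ResolutionOfSingularities.Theorems

universe u

namespace CuspDepthFour

/-! ## Notation: the factors on the `y`-chart and their `a`-chart residuals -/

/-- `Π₂`-avatar image `P = (a²) + (c) + (t²)`. -/
local notation3 "Pf[" t "," c "," a "]" => (Ideal.span {a ^ 2} ⊔ Ideal.span {c} ⊔ Ideal.span {t ^ 2})
/-- `Σ̃`-avatar image `Σ = (c) + (t a) + (t²)`. -/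
local notation3 "Sf[" t "," c "," a "]" => (Ideal.span {c} ⊔ Ideal.span {t * a} ⊔ Ideal.span {t ^ 2})
/-- The member `K = (c² + t a³) + (t⁴)`. -/
local notation3 "Kf[" t "," c "," a "]" => (Ideal.span {c ^ 2 + t * a ^ 3} ⊔ Ideal.span {t ^ 4})
/-- Tangent-Euclid avatar image `B_{k+2} = (a^{2k}(c² + t a³)) + (c^{k+2}) + (t^{2k+4})`. -/
local notation3 "Bf[" t "," c "," a "," k "]" =>
  (Ideal.span {a ^ (2 * k) * (c ^ 2 + t * a ^ 3)} ⊔ Ideal.span {c ^ (k + 2)} ⊔ Ideal.span {t ^ (2 * k + 4)})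
/-- The full `y`-chart product (without the centre `(t, a, c)`). -/
local notation3 "Ff[" t "," c "," a "]" =>
  (Pf[t,c,a] * Sf[t,c,a] * Kf[t,c,a] * ∏ k ∈ Finset.range 6, Bf[t,c,a,k])
/-- `a`-chart residual of `P`: the surface `Π₂ = (a, c′)`. -/
local notation3 "Pa[" t "," c "," a "]" => (Ideal.span {a} ⊔ Ideal.span {c})
/-- `a`-chart residual of `Σ`: `(c′, a t′)`. -/
local notation3 "Sa[" t "," c "," a "]" => (Ideal.span {c} ⊔ Ideal.span {a * t})
/-- `a`-chart residual of `K`: `(c′² + t′ a²) + (a² t′⁴)`. -/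
local notation3 "Ka[" t "," c "," a "]" => (Ideal.span {c ^ 2 + t * a ^ 2} ⊔ Ideal.span {a ^ 2 * t ^ 4})
/-- `a`-chart residual of `B_{k+2}`: `(a^k (c′² + t′ a²)) + (c′^{k+2}) + (a^{k+2} t′^{2k+4})`. -/
local notation3 "Ba[" t "," c "," a "," k "]" =>
  (Ideal.span {a ^ k * (c ^ 2 + t * a ^ 2)} ⊔ Ideal.span {c ^ (k + 2)} ⊔ Ideal.span {a ^ (k + 2) * t ^ (2 * k + 4)})
/-- The full `a`-chart residual. -/
local notation3 "Fa[" t "," c "," a "]" =>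
  (Pa[t,c,a] * Sa[t,c,a] * Ka[t,c,a] * ∏ k ∈ Finset.range 6, Ba[t,c,a,k])
/-- `t`-chart residual of `B_{k+2}`: `(t^k a₁^{2k} (c₁² + t² a₁³)) + (c₁^{k+2}) + (t^{k+2})`. -/
local notation3 "Bt[" T "," C "," A "," k "]" =>
  (Ideal.span {T ^ k * A ^ (2 * k) * (C ^ 2 + T ^ 2 * A ^ 3)} ⊔ Ideal.span {C ^ (k + 2)} ⊔
    Ideal.span {T ^ (k + 2)})
/-- The `t`-chart residual WITHOUT one copy of the centre `(c₁, t)` of the surface step: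
`(c₁, t) · (c₁², t²) · ∏ Bt`. -/
local notation3 "Jt[" T "," C "," A "]" =>
  ((Ideal.span {C} ⊔ Ideal.span {T}) * (Ideal.span {C ^ 2} ⊔ Ideal.span {T ^ 2}) *
    ∏ k ∈ Finset.range 6, Bt[T,C,A,k])

section Algebra

variable {A : Type u} [CommRing A]

/-! ### `a`-chart identities (`t = a t′`, `c = a c′`) -/

/-- `P · B_a = a · (a, c′)`. [folklore] -/
theorem aChart_P (a t' c' : A) :
    Pf[a * t', a * c', a] = Ideal.span {a} * Pa[t', c', a] := by
  rw [Ideal.mul_sup, Ideal.span_singleton_mul_span_singleton, Ideal.span_singleton_mul_span_singleton]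
  have e1 : a ^ 2 = a * a := by ring
  rw [e1]
  exact sup_eq_left.mpr (le_sup_of_le_left (Ideal.span_singleton_le_span_singleton.mpr ⟨t' ^ 2, by ring⟩))

/-- `Σ · B_a = a · (c′, a t′)`. [folklore] -/
theorem aChart_S (a t' c' : A) :
    Sf[a * t', a * c', a] = Ideal.span {a} * Sa[t', c', a] := by
  rw [Ideal.mul_sup, Ideal.span_singleton_mul_span_singleton, Ideal.span_singleton_mul_span_singleton]
  have e1 : a * t' * a = a * (a * t') := by ring
  rw [e1]
  exact sup_eq_left.mpr (le_sup_of_le_right (Ideal.span_singleton_le_span_singleton.mpr ⟨t', by ring⟩))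

/-- `K · B_a = a² · ((c′² + t′ a²) + (a² t′⁴))`. [folklore] -/
theorem aChart_K (a t' c' : A) :
    Kf[a * t', a * c', a] = Ideal.span {a ^ 2} * Ka[t', c', a] := by
  rw [Ideal.mul_sup, Ideal.span_singleton_mul_span_singleton, Ideal.span_singleton_mul_span_singleton]
  have e1 : (a * c') ^ 2 + a * t' * a ^ 3 = a ^ 2 * (c' ^ 2 + t' * a ^ 2) := by ring
  have e2 : (a * t') ^ 4 = a ^ 2 * (a ^ 2 * t' ^ 4) := by ring
  rw [e1, e2]

/-- `B_{k+2} · B_a = a^{k+2} · ((a^k (c′² + t′ a²)) + (c′^{k+2}) + (a^{k+2} t′^{2k+4}))`. [folklore] -/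
theorem aChart_B (a t' c' : A) (k : ℕ) :
    Bf[a * t', a * c', a, k] = Ideal.span {a ^ (k + 2)} * Ba[t', c', a, k] := by
  rw [Ideal.mul_sup, Ideal.mul_sup, Ideal.span_singleton_mul_span_singleton,
    Ideal.span_singleton_mul_span_singleton, Ideal.span_singleton_mul_span_singleton]
  have e1 : a ^ (2 * k) * ((a * c') ^ 2 + a * t' * a ^ 3) = a ^ (k + 2) * (a ^ k * (c' ^ 2 + t' * a ^ 2)) := by
    ring
  have e2 : (a * c') ^ (k + 2) = a ^ (k + 2) * c' ^ (k + 2) := by ring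
  have e3 : (a * t') ^ (2 * k + 4) = a ^ (k + 2) * (a ^ (k + 2) * t' ^ (2 * k + 4)) := by ring
  rw [e1, e2, e3]

/-! ### `t`-chart identities (`c = t c₁`, `a = t a₁`) -/

/-- `P · B_t = t · (c₁, t)`. [folklore] -/
theorem tChart_P (t c₁ a₁ : A) :
    Pf[t, t * c₁, t * a₁] = Ideal.span {t} * (Ideal.span {c₁} ⊔ Ideal.span {t}) := by
  rw [Ideal.mul_sup, Ideal.span_singleton_mul_span_singleton, Ideal.span_singleton_mul_span_singleton]
  have h1 : Ideal.span {(t * a₁) ^ 2} ≤ Ideal.span {t * c₁} ⊔ Ideal.span {t * t} :=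
    le_sup_of_le_right (Ideal.span_singleton_le_span_singleton.mpr ⟨a₁ ^ 2, by ring⟩)
  have h2 : Ideal.span {t ^ 2} = Ideal.span {t * t} := by rw [pow_two]
  rw [h2]
  exact le_antisymm (sup_le (sup_le h1 le_sup_left) le_sup_right)
    (sup_le (le_sup_of_le_left le_sup_right) le_sup_right)

/-- `Σ · B_t = t · (c₁, t)`. [folklore] -/
theorem tChart_S (t c₁ a₁ : A) :
    Sf[t, t * c₁, t * a₁] = Ideal.span {t} * (Ideal.span {c₁} ⊔ Ideal.span {t}) := by
  rw [Ideal.mul_sup, Ideal.span_singleton_mul_span_singleton, Ideal.span_singleton_mul_span_singleton]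
  have e1 : t ^ 2 = t * t := by ring
  rw [e1, sup_assoc]
  exact congrArg _ (sup_eq_right.mpr (Ideal.span_singleton_le_span_singleton.mpr ⟨a₁, by ring⟩))

/-- `K · B_t = t² · (c₁², t²)` (`c₁² + t² a₁³ ≡ c₁²` modulo `t²`). [folklore] -/
theorem tChart_K (t c₁ a₁ : A) :
    Kf[t, t * c₁, t * a₁] = Ideal.span {t ^ 2} * (Ideal.span {c₁ ^ 2} ⊔ Ideal.span {t ^ 2}) := by
  rw [Ideal.mul_sup, Ideal.span_singleton_mul_span_singleton, Ideal.span_singleton_mul_span_singleton]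
  have e1 : (t * c₁) ^ 2 + t * (t * a₁) ^ 3 = t ^ 2 * (c₁ ^ 2 + t ^ 2 * a₁ ^ 3) := by ring
  have e2 : t ^ 4 = t ^ 2 * t ^ 2 := by ring
  rw [e1, e2, sup_comm (Ideal.span {t ^ 2 * (c₁ ^ 2 + t ^ 2 * a₁ ^ 3)}), sup_comm (Ideal.span {t ^ 2 * c₁ ^ 2})]
  exact CoreRungTower.sup_span_singleton_eq_of_sub_mem (by
    have e : t ^ 2 * (c₁ ^ 2 + t ^ 2 * a₁ ^ 3) - t ^ 2 * c₁ ^ 2 = a₁ ^ 3 * (t ^ 2 * t ^ 2) := by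
      ring
    rw [e]
    exact Ideal.mul_mem_left _ _ (Ideal.mem_span_singleton_self _))

/-- `B_{k+2} · B_t = t^{k+2} · ((t^k a₁^{2k} (c₁² + t² a₁³)) + (c₁^{k+2}) + (t^{k+2}))`. [folklore] -/
theorem tChart_B (t c₁ a₁ : A) (k : ℕ) :
    Bf[t, t * c₁, t * a₁, k] = Ideal.span {t ^ (k + 2)} * Bt[t, c₁, a₁, k] := by
  rw [Ideal.mul_sup, Ideal.mul_sup, Ideal.span_singleton_mul_span_singleton,
    Ideal.span_singleton_mul_span_singleton, Ideal.span_singleton_mul_span_singleton]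
  have e1 : (t * a₁) ^ (2 * k) * ((t * c₁) ^ 2 + t * (t * a₁) ^ 3) =
      t ^ (k + 2) * (t ^ k * a₁ ^ (2 * k) * (c₁ ^ 2 + t ^ 2 * a₁ ^ 3)) := by ring
  have e2 : (t * c₁) ^ (k + 2) = t ^ (k + 2) * c₁ ^ (k + 2) := by ring
  have e3 : t ^ (2 * k + 4) = t ^ (k + 2) * t ^ (k + 2) := by ring
  rw [e1, e2, e3]

/-! ### `c`-chart identities (`t = c t₃`, `a = c a₃`): everything principal -/

/-- `P · B_c = (c)`. [folklore] -/
theorem cChart_P (c t₃ a₃ : A) : Pf[c * t₃, c, c * a₃] = Ideal.span {c} := by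
  have h1 : Ideal.span {(c * a₃) ^ 2} ≤ Ideal.span {c} :=
    Ideal.span_singleton_le_span_singleton.mpr ⟨c * a₃ ^ 2, by ring⟩
  have h2 : Ideal.span {(c * t₃) ^ 2} ≤ Ideal.span {c} :=
    Ideal.span_singleton_le_span_singleton.mpr ⟨c * t₃ ^ 2, by ring⟩
  exact le_antisymm (sup_le (sup_le h1 le_rfl) h2) (le_sup_of_le_left le_sup_right)

/-- `Σ · B_c = (c)`. [folklore] -/
theorem cChart_S (c t₃ a₃ : A) : Sf[c * t₃, c, c * a₃] = Ideal.span {c} := by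
  have h1 : Ideal.span {c * t₃ * (c * a₃)} ≤ Ideal.span {c} :=
    Ideal.span_singleton_le_span_singleton.mpr ⟨t₃ * (c * a₃), by ring⟩
  have h2 : Ideal.span {(c * t₃) ^ 2} ≤ Ideal.span {c} :=
    Ideal.span_singleton_le_span_singleton.mpr ⟨c * t₃ ^ 2, by ring⟩
  exact le_antisymm (sup_le (sup_le le_rfl h1) h2) (le_sup_of_le_left le_sup_left)

/-- `K · B_c = (c²)` (`1 + c² t₃ a₃³` is a unit modulo `(c² t₃⁴)` up to nilpotents). [folklore] -/
theorem cChart_K (c t₃ a₃ : A) : Kf[c * t₃, c, c * a₃] = Ideal.span {c ^ 2} := by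
  have e1 : c ^ 2 + c * t₃ * (c * a₃) ^ 3 = c ^ 2 * (1 + c ^ 2 * t₃ * a₃ ^ 3) := by ring
  have e2 : (c * t₃) ^ 4 = c ^ 2 * (c ^ 2 * t₃ ^ 4) := by ring
  rw [e1, e2, ← Ideal.span_singleton_mul_span_singleton, ← Ideal.span_singleton_mul_span_singleton,
    ← Ideal.mul_sup]
  have hP : Ideal.span {1 + c ^ 2 * t₃ * a₃ ^ 3} ⊔ Ideal.span {c ^ 2 * t₃ ^ 4} = ⊤ := by
    refine CoreRungTower.eq_top_of_isUnit_eq_sub isUnit_one (h := 1 + c ^ 2 * t₃ * a₃ ^ 3)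
      (n := c ^ 2 * t₃ * a₃ ^ 3) (by ring) _ 1 4 ?_ ?_
    · rw [pow_one]; exact Ideal.mem_sup_left (Ideal.mem_span_singleton_self _)
    · refine Ideal.mem_sup_right (Ideal.mem_span_singleton.mpr ⟨c ^ 6 * a₃ ^ 12, ?_⟩)
      ring
  rw [hP, Ideal.mul_top]

/-- `B_{k+2} · B_c = (c^{k+2})`. [folklore] -/
theorem cChart_B (c t₃ a₃ : A) (k : ℕ) : Bf[c * t₃, c, c * a₃, k] = Ideal.span {c ^ (k + 2)} := by
  have h1 : Ideal.span {(c * a₃) ^ (2 * k) * (c ^ 2 + c * t₃ * (c * a₃) ^ 3)} ≤ Ideal.span {c ^ (k + 2)} :=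
    Ideal.span_singleton_le_span_singleton.mpr ⟨c ^ k * a₃ ^ (2 * k) * (1 + c ^ 2 * t₃ * a₃ ^ 3), by ring⟩
  have h2 : Ideal.span {(c * t₃) ^ (2 * k + 4)} ≤ Ideal.span {c ^ (k + 2)} :=
    Ideal.span_singleton_le_span_singleton.mpr ⟨c ^ (k + 2) * t₃ ^ (2 * k + 4), by ring⟩
  exact le_antisymm (sup_le (sup_le h1 le_rfl) h2) (le_sup_of_le_left le_sup_right)

/-! ### The `t`-chart residual and its two sub-charts after the surface step `Π₂ = (t, c₁)` -/

/-- `T`-sub-chart (`c₁ = T c₂`): `(c₁, T) ↦ (T)`. [folklore] -/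
theorem tSub_Z (T c₂ : A) : Ideal.span {T * c₂} ⊔ Ideal.span {T} = Ideal.span {T} :=
  sup_eq_right.mpr (Ideal.span_singleton_le_span_singleton.mpr ⟨c₂, by ring⟩)

/-- `T`-sub-chart: `(c₁², T²) ↦ (T²)`. [folklore] -/
theorem tSub_K (T c₂ : A) : Ideal.span {(T * c₂) ^ 2} ⊔ Ideal.span {T ^ 2} = Ideal.span {T ^ 2} :=
  sup_eq_right.mpr (Ideal.span_singleton_le_span_singleton.mpr ⟨c₂ ^ 2, by ring⟩)

/-- `T`-sub-chart: `B ↦ (T^{k+2})`. [folklore] -/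
theorem tSub_B (T c₂ a₁ : A) (k : ℕ) :
    Ideal.span {T ^ k * a₁ ^ (2 * k) * ((T * c₂) ^ 2 + T ^ 2 * a₁ ^ 3)} ⊔ Ideal.span {(T * c₂) ^ (k + 2)} ⊔
      Ideal.span {T ^ (k + 2)} = Ideal.span {T ^ (k + 2)} := by
  have h1 : Ideal.span {T ^ k * a₁ ^ (2 * k) * ((T * c₂) ^ 2 + T ^ 2 * a₁ ^ 3)} ≤ Ideal.span {T ^ (k + 2)} :=
    Ideal.span_singleton_le_span_singleton.mpr ⟨a₁ ^ (2 * k) * (c₂ ^ 2 + a₁ ^ 3), by ring⟩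
  have h2 : Ideal.span {(T * c₂) ^ (k + 2)} ≤ Ideal.span {T ^ (k + 2)} :=
    Ideal.span_singleton_le_span_singleton.mpr ⟨c₂ ^ (k + 2), by ring⟩
  exact le_antisymm (sup_le (sup_le h1 h2) le_rfl) le_sup_right

/-- `C₁`-sub-chart (`T = C t₂`): `(C, T) ↦ (C)`. [folklore] -/
theorem cSub_Z (C t₂ : A) : Ideal.span {C} ⊔ Ideal.span {C * t₂} = Ideal.span {C} :=
  sup_eq_left.mpr (Ideal.span_singleton_le_span_singleton.mpr ⟨t₂, by ring⟩)

/-- `C₁`-sub-chart: `(C², T²) ↦ (C²)`. [folklore] -/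
theorem cSub_K (C t₂ : A) : Ideal.span {C ^ 2} ⊔ Ideal.span {(C * t₂) ^ 2} = Ideal.span {C ^ 2} :=
  sup_eq_left.mpr (Ideal.span_singleton_le_span_singleton.mpr ⟨t₂ ^ 2, by ring⟩)

/-- `C₁`-sub-chart: `B ↦ (C^{k+2})`. [folklore] -/
theorem cSub_B (C t₂ a₁ : A) (k : ℕ) :
    Ideal.span {(C * t₂) ^ k * a₁ ^ (2 * k) * (C ^ 2 + (C * t₂) ^ 2 * a₁ ^ 3)} ⊔ Ideal.span {C ^ (k + 2)} ⊔
      Ideal.span {(C * t₂) ^ (k + 2)} = Ideal.span {C ^ (k + 2)} := by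
  have h1 : Ideal.span {(C * t₂) ^ k * a₁ ^ (2 * k) * (C ^ 2 + (C * t₂) ^ 2 * a₁ ^ 3)} ≤
      Ideal.span {C ^ (k + 2)} :=
    Ideal.span_singleton_le_span_singleton.mpr ⟨t₂ ^ k * a₁ ^ (2 * k) * (1 + t₂ ^ 2 * a₁ ^ 3), by ring⟩
  have h2 : Ideal.span {(C * t₂) ^ (k + 2)} ≤ Ideal.span {C ^ (k + 2)} :=
    Ideal.span_singleton_le_span_singleton.mpr ⟨t₂ ^ (k + 2), by ring⟩
  exact le_antisymm (sup_le (sup_le h1 le_rfl) h2) (le_sup_of_le_left le_sup_right)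

/-- `Σ_{k<6} (k+2) = 27`. [folklore] -/
theorem sum_range_six : ∑ k ∈ Finset.range 6, (k + 2) = 27 := by decide

/-- Collecting the Cartier twist on the `a`-chart (abstract ring, cheap instances). [folklore] -/
theorem collect_two (g : A) (P S K X : Ideal A) :
    Ideal.span {g} * P * (Ideal.span {g} * S) * (Ideal.span {g ^ 2} * K) * (Ideal.span {g ^ 27} * X) =
      Ideal.span {g * g * g ^ 2 * g ^ 27} * (P * S * K * X) := by
  rw [← Ideal.span_singleton_mul_span_singleton, ← Ideal.span_singleton_mul_span_singleton,
    ← Ideal.span_singleton_mul_span_singleton]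
  ring

/-- Collecting the Cartier twist on the `t`-chart and moving one copy of the centre to the end.
[folklore] -/
theorem collect_zero (g : A) (Z K X : Ideal A) :
    Ideal.span {g} * Z * (Ideal.span {g} * Z) * (Ideal.span {g ^ 2} * K) * (Ideal.span {g ^ 27} * X) =
      Ideal.span {g * g * g ^ 2 * g ^ 27} * (Z * K * X * Z) := by
  rw [← Ideal.span_singleton_mul_span_singleton, ← Ideal.span_singleton_mul_span_singleton,
    ← Ideal.span_singleton_mul_span_singleton]
  ring

end Algebra

/-! ## The surface step on the `t`-chart: both sub-charts of `Bl_{(T, C)}` are Cartier -/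

section SubCharts

variable {B : Type u} [CommRing B] (T C A₁ : B)

local notation3 "yy" => (![T, C] : Fin 2 → B)

set_option maxHeartbeats 400000 in
-- instance-path defeq through `HomogeneousLocalization`'s standalone `Pow`/`Mul` (as in p508825)
/-- `T`-sub-chart image of the `t`-chart residual: the principal monomial `(T · T² · T²⁷)`.
[cite: StacksProject, Tag 0804] -/
theorem map_Jt_zero :
    (Jt[T,C,A₁]).map (chartBase yy 0) =
      Ideal.span {chartBase yy 0 T * chartBase yy 0 T ^ 2 * chartBase yy 0 T ^ 27} := by
  have cb : chartBase yy 0 C = chartBase yy 0 T * chartGen yy 0 1 :=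
    reesChartBase_apply_eq_mul_chartGen yy 0 1
  have hZ : (Ideal.span {C} ⊔ Ideal.span {T}).map (chartBase yy 0) = Ideal.span {chartBase yy 0 T} := by
    rw [Ideal.map_sup, CuspMember.map_span_singleton, CuspMember.map_span_singleton, cb]
    exact tSub_Z _ _
  have hK : (Ideal.span {C ^ 2} ⊔ Ideal.span {T ^ 2}).map (chartBase yy 0) =
      Ideal.span {chartBase yy 0 T ^ 2} := by
    rw [Ideal.map_sup, CuspMember.map_span_singleton, CuspMember.map_span_singleton, map_pow, map_pow, cb]
    exact tSub_K _ _
  have hB : ∀ k : ℕ, (Bt[T,C,A₁,k]).map (chartBase yy 0) = Ideal.span {chartBase yy 0 T ^ (k + 2)} := by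
    intro k
    rw [Ideal.map_sup, Ideal.map_sup, CuspMember.map_span_singleton, CuspMember.map_span_singleton,
      CuspMember.map_span_singleton, map_mul, map_mul, map_pow, map_pow, map_add, map_pow, map_mul,
      map_pow, map_pow, map_pow, map_pow, cb]
    exact tSub_B _ _ _ k
  rw [Ideal.map_mul, Ideal.map_mul, CoreRungTower.map_prod_range, hZ, hK]
  simp_rw [hB]
  rw [Ideal.prod_span_singleton, Finset.prod_pow_eq_pow_sum, sum_range_six,
    Ideal.span_singleton_mul_span_singleton, Ideal.span_singleton_mul_span_singleton]

set_option maxHeartbeats 400000 in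
-- instance-path defeq through `HomogeneousLocalization`'s standalone `Pow`/`Mul` (as in p508825)
/-- `C`-sub-chart image of the `t`-chart residual: the principal monomial `(C · C² · C²⁷)`.
[cite: StacksProject, Tag 0804] -/
theorem map_Jt_one :
    (Jt[T,C,A₁]).map (chartBase yy 1) =
      Ideal.span {chartBase yy 1 C * chartBase yy 1 C ^ 2 * chartBase yy 1 C ^ 27} := by
  have cb : chartBase yy 1 T = chartBase yy 1 C * chartGen yy 1 0 :=
    reesChartBase_apply_eq_mul_chartGen yy 1 0
  have hZ : (Ideal.span {C} ⊔ Ideal.span {T}).map (chartBase yy 1) = Ideal.span {chartBase yy 1 C} := by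
    rw [Ideal.map_sup, CuspMember.map_span_singleton, CuspMember.map_span_singleton, cb]
    exact cSub_Z _ _
  have hK : (Ideal.span {C ^ 2} ⊔ Ideal.span {T ^ 2}).map (chartBase yy 1) =
      Ideal.span {chartBase yy 1 C ^ 2} := by
    rw [Ideal.map_sup, CuspMember.map_span_singleton, CuspMember.map_span_singleton, map_pow, map_pow, cb]
    exact cSub_K _ _
  have hB : ∀ k : ℕ, (Bt[T,C,A₁,k]).map (chartBase yy 1) = Ideal.span {chartBase yy 1 C ^ (k + 2)} := by
    intro k
    rw [Ideal.map_sup, Ideal.map_sup, CuspMember.map_span_singleton, CuspMember.map_span_singleton,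
      CuspMember.map_span_singleton, map_mul, map_mul, map_pow, map_pow, map_add, map_pow, map_mul,
      map_pow, map_pow, map_pow, map_pow, cb]
    exact cSub_B _ _ _ k
  rw [Ideal.map_mul, Ideal.map_mul, CoreRungTower.map_prod_range, hZ, hK]
  simp_rw [hB]
  rw [Ideal.prod_span_singleton, Finset.prod_pow_eq_pow_sum, sum_range_six,
    Ideal.span_singleton_mul_span_singleton, Ideal.span_singleton_mul_span_singleton]

set_option maxHeartbeats 400000 in
-- instance-path defeq through `HomogeneousLocalization`'s standalone `Pow`/`Mul` (as in p508825)
/-- **The surface step resolves the `t`-chart residual**: for `(T, C)` quasi-regular with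
`B/(T, C)` regular in a regular ring `B`, every blowing up of `Spec B` along `Jt · (T, C)` is
regular (both charts of `Bl_{(T, C)}` are Cartier). [cite: StacksProject, Tag 080A] -/
theorem isRegular_of_isBlowup_Jt [IsRegularRing B] (hy : IsQuasiRegular yy)
    (hBy : IsRegularRing (B ⧸ Ideal.span (Set.range yy)))
    {Y : Scheme.{u}} {ρ : Y ⟶ Spec (.of B)}
    (hρ : IsBlowup ρ (affineBlowup.idealSheaf (Jt[T,C,A₁] * Ideal.span (Set.range yy)))) :
    Scheme.IsRegular Y := by
  haveI := hBy
  refine isRegular_of_isBlowup_mul_of_charts yy _ (fun i Y' σ hσ => ?_) hρ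
  haveI hB' : IsRegularRing (chartRing yy i) := isRegularRing_blowupChart _ i hy
  have hi : i = 0 ∨ i = 1 := by
    fin_cases i
    · exact Or.inl rfl
    · exact Or.inr rfl
  rcases hi with rfl | rfl
  · have hT : chartBase yy 0 T ∈ (chartRing yy 0)⁰ :=
      reesChartBase_mem_nonZeroDivisors (yy 0) (Ideal.mem_span_range_self (f := yy) (x := 0))
    rw [map_Jt_zero] at hσ
    have hσ2 : IsBlowup σ (affineBlowup.idealSheaf
        (Ideal.span {chartBase yy 0 T * chartBase yy 0 T ^ 2 * chartBase yy 0 T ^ 27} * ⊤)) := by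
      rwa [Ideal.mul_top]
    refine CoreRungTower.isRegular_of_isBlowup_span_singleton_mul
      (mul_mem (mul_mem hT (pow_mem hT 2)) (pow_mem hT 27)) _ (fun Y'' τ hτ => ?_) hσ2
    rw [affineBlowup.idealSheaf_top] at hτ
    haveI : IsIso τ := hτ.isIso isEffectiveCartier_top
    haveI : IsRegularRing (CommRingCat.of (chartRing yy 0)) := hB'
    exact SectionAscent.TraceIdeal.isRegular_of_iso (asIso τ) (Scheme.isRegular_Spec _)
  · have hC : chartBase yy 1 C ∈ (chartRing yy 1)⁰ :=
      reesChartBase_mem_nonZeroDivisors (yy 1) (Ideal.mem_span_range_self (f := yy) (x := 1))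
    rw [map_Jt_one] at hσ
    have hσ2 : IsBlowup σ (affineBlowup.idealSheaf
        (Ideal.span {chartBase yy 1 C * chartBase yy 1 C ^ 2 * chartBase yy 1 C ^ 27} * ⊤)) := by
      rwa [Ideal.mul_top]
    refine CoreRungTower.isRegular_of_isBlowup_span_singleton_mul
      (mul_mem (mul_mem hC (pow_mem hC 2)) (pow_mem hC 27)) _ (fun Y'' τ hτ => ?_) hσ2
    rw [affineBlowup.idealSheaf_top] at hτ
    haveI : IsIso τ := hτ.isIso isEffectiveCartier_top
    haveI : IsRegularRing (CommRingCat.of (chartRing yy 1)) := hB'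
    exact SectionAscent.TraceIdeal.isRegular_of_iso (asIso τ) (Scheme.isRegular_Spec _)

end SubCharts


end CuspDepthFour

end Summit.ResolutionOfSingularities.ResolutionOfSingularities.Theorems

end
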